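import Summits.BirchSwinnertonDyer.BirchSwinnertonDyer.Theorems.CMKolyvaginAtInertTwoShaCountTwistModelAtTwo
import Summits.BirchSwinnertonDyer.BirchSwinnertonDyer.Theorems.CMKolyvaginAtInertTwoShaCountTamagawaTwistAtTwo
import HarnessLib

/-!
# Route `CMKolyvaginAtInertTwo`, crux `CMKolyvaginExactAtInertTwo` (stmt-BirchSwinnertonDyer-24277):
# THE COUNT IDENTITY, XIV — COMPOSITE (odd) `d_K`: the globally minimal twist model with unit
# scaling, and `ord₂ ∏_ℓ c_ℓ(E^{(d_K)}) = ord₂ ∏_ℓ c_ℓ(E) + Σ_{q ∣ d_K} ([(Δ/q) = −1] + 2·[(Δ/q) = 1 ∧ a_q even])`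

Seat `bsd-line-cmk2-p1` g15 (cell `bsd-print-cf2`); helper (`--supports stmt-BirchSwinnertonDyer-24277`).
THEOREMS ONLY: no definition, no named fact, no `sorry`; no item is closed; BSD is not proved by this.

Files VI and IIIb assumed `|d_K|` PRIME. The sibling cruxes of route `GenusKolyvaginAtTwo` (habitats
R, T) only assume `d_K` odd, so the bridge `#Ш(E_K)[2^∞] ↔ #Ш(E)[2^∞]·#Ш(E^{(d_K)})[2^∞]` is needed
for every odd fundamental `d_K` satisfying the Heegner hypothesis. This file removes primality from
the two inputs of the count identity that used it:

* `isGloballyMinimal_twistModel_of_squarefree` — for `d ≡ 1 (mod 4)` squarefree and `W` globally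
  minimal with good reduction at every place dividing `d`, the integral twist model
  `W.twistModel ((d−1)/4)` is globally minimal (Stevens' Tate-algorithm step, place by place:
  `ord_v Δ = 6 < 12` at `v ∣ d`, `v`-unit parameter elsewhere);
* `exists_isGloballyMinimal_twist_of_heegner` — **for `K` imaginary quadratic with `d_K` odd and the
  Heegner hypothesis for `N(W)`, the twist `W^{(d_K)}` has a globally minimal model `Cd • W^{(d_K)}`
  with `|u(Cd)| = 1`** (every `q ∣ d_K` ramifies, hence `q ∤ N`, `W` good at `q`);
* `padicValNat_two_localTamagawaNumber_twist_eq_add_of_heegner` — prime by prime: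
  `ord₂ c_ℓ(E^{(d_K)}) = ord₂ c_ℓ(E) + [ℓ ∣ d_K]·([(Δ/ℓ) = −1] + 2·[(Δ/ℓ) = 1 ∧ a_ℓ even])`;
* `padicValNat_two_tamagawaProduct_twist_of_heegner` — **`ord₂ ∏c(E^{(d_K)}) = ord₂ ∏c(E) +
  Σ_{q ∈ primeFactors |d_K|} ([(Δ/q) = −1] + 2·[(Δ/q) = 1 ∧ a_q(E) even])`** (`Δ = W.Δ.num`, the
  minimal discriminant).

References: Stevens 1989 Lemma (5.2); Silverman AEC VII.1; Kramer 1981 Prop. 3; Boxer–Diao 2010 Prop. 4.1.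
-/

-- single-conjunct summit: `Summit.BirchSwinnertonDyer.BirchSwinnertonDyer.…` repeats the name by design
set_option linter.dupNamespace false
set_option autoImplicit false

noncomputable section

open scoped Classical

open IsDedekindDomain IsDedekindDomain.HeightOneSpectrum NumberField Rat.HeightOneSpectrum
  WeierstrassCurve Literature.NumberTheory.EllipticCurves
  Literature.NumberTheory.EllipticCurves.ModularForms Literature.NumberTheory.QuadraticFields
  Literature.NumberTheory.EllipticCurves.Rank1Residual
  Summit.BirchSwinnertonDyer.Rank1Residual Summit.BirchSwinnertonDyer.Rank1Residual.X2

namespace Summit.BirchSwinnertonDyer.BirchSwinnertonDyer.Theorems.ShaCountTwo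

/-! ## §1 The globally minimal twist model for squarefree `d ≡ 1 (mod 4)` -/

/-- **The integral twist model by a squarefree `d ≡ 1 (mod 4)` of a globally minimal `W` with good
reduction at the places dividing `d` is globally minimal** (`k = (d − 1)/4`, `4k + 1 = d`). At a
place `v ∤ d`: `d` is a `v`-unit and `WeierstrassCurve.isMinimalAt_twistModel` applies; at `v ∣ d`
(`v ∥ d` as `d` is squarefree): the model has integer coefficients and `Δ ↦ d⁶Δ` with
`ord_v Δ(W) = 0`, so `ord_v Δ = 6 < 12` and the equation is minimal (Silverman AEC VII.1 Rem. 1.1).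
The prime case (`d = q*`, also allowing multiplicative reduction) is the tree's
`isGloballyMinimal_twistModel_pStar`. [cite: SilvermanAEC2009, VII.1 Remark 1.1 and Prop. 1.3]
[cite: Stevens1989, Lemma (5.2) p. 96 (sketch of proof)] -/
theorem isGloballyMinimal_twistModel_of_squarefree (W : WeierstrassCurve ℚ) [W.IsElliptic]
    [W.IsGloballyMinimal] {d : ℤ} (h4 : (4 : ℤ) ∣ d - 1) (hsf : Squarefree d)
    (hgood : ∀ v : HeightOneSpectrum (𝓞 ℚ), ((primesEquiv v : ℕ) : ℤ) ∣ d → W.HasGoodReductionAt v) :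
    (W.twistModel (((d - 1) / 4 : ℤ) : ℚ)).IsGloballyMinimal := by
  set k : ℤ := (d - 1) / 4 with hk
  have h4k : (4 : ℤ) * k + 1 = d := by
    have := Int.ediv_mul_cancel h4
    linarith
  have h4kℚ : (4 : ℚ) * (k : ℚ) + 1 = (d : ℚ) := by exact_mod_cast h4k
  -- integrality over `𝓞 ℚ`
  have hkO : algebraMap (𝓞 ℚ) ℚ ((k : ℤ) : 𝓞 ℚ) = (k : ℚ) := by simp
  have hint : IsIntegral (𝓞 ℚ) (W.twistModel (k : ℚ)) := by
    have := isIntegral_twistModel (𝓞 ℚ) W ((k : ℤ) : 𝓞 ℚ)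
    rwa [hkO] at this
  -- the integer model and the valuations of the coefficients of the twist model
  set M : WeierstrassCurve ℤ := integralModelInt W with hM
  have hWM : M.map (Int.castRingHom ℚ) = W := map_integralModelInt W
  have hTM : (M.twistModel k).map (Int.castRingHom ℚ) = W.twistModel (k : ℚ) := by
    rw [map_twistModel, hWM, eq_intCast]
  have hintv : ∀ v : HeightOneSpectrum (𝓞 ℚ), (W.twistModel (k : ℚ)).IsIntegralAt v := by
    intro v
    refine (W.twistModel (k : ℚ)).isIntegralAt_of_valuation_le_one v ?_ ?_ ?_ ?_ ?_
    · rw [← hTM, map_a₁, eq_intCast]; exact valuation_ringOfIntegers_intCast_le_one v _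
    · rw [← hTM, map_a₂, eq_intCast]; exact valuation_ringOfIntegers_intCast_le_one v _
    · rw [← hTM, map_a₃, eq_intCast]; exact valuation_ringOfIntegers_intCast_le_one v _
    · rw [← hTM, map_a₄, eq_intCast]; exact valuation_ringOfIntegers_intCast_le_one v _
    · rw [← hTM, map_a₆, eq_intCast]; exact valuation_ringOfIntegers_intCast_le_one v _
  refine ⟨hint, fun v ↦ ?_⟩
  by_cases hvd : ((primesEquiv v : ℕ) : ℤ) ∣ d
  · -- a ramified place `v ∣ d`: `v ∥ d`, `W` good at `v`, `ord_v Δ(T) = 6`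
    have hsq : ¬ ((primesEquiv v : ℕ) : ℤ) ^ 2 ∣ d := by
      intro h
      have hunit := hsf ((primesEquiv v : ℕ) : ℤ) (by rw [← sq]; exact h)
      rw [Int.isUnit_iff_natAbs_eq, Int.natAbs_natCast] at hunit
      exact (primesEquiv v).2.one_lt.ne' hunit
    have hvdv : v.valuation ℚ (d : ℚ) = WithZero.exp (-1 : ℤ) :=
      valuation_ringOfIntegers_intCast_eq_exp_neg_one v hvd hsq
    have hv4k : v.valuation ℚ (4 * (k : ℚ) + 1) = WithZero.exp (-1 : ℤ) := by rw [h4kℚ, hvdv]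
    have hvΔ : v.valuation ℚ W.Δ = 1 :=
      (hasGoodReductionAt_iff_of_isMinimalAt (v := v) (W := W)
        (IsGloballyMinimal.isMinimal v)).mp (hgood v hvd)
    have hΔ : v.valuation ℚ (W.twistModel (k : ℚ)).Δ = WithZero.exp (-6 : ℤ) := by
      rw [twistModel_Δ, map_mul, map_pow, hv4k, hvΔ, mul_one, ← WithZero.exp_nsmul]
      norm_num
    exact isMinimalAt_of_lt_valuation_Δ_holds (hintv v)
      (by rw [hΔ]; exact WithZero.exp_lt_exp.mpr (by norm_num))
  · -- an unramified place: `d` is a `v`-unit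
    have hvdv : v.valuation ℚ (d : ℚ) = 1 := valuation_ringOfIntegers_intCast_eq_one v hvd
    have hv4k : v.valuation ℚ (4 * (k : ℚ) + 1) = 1 := by rw [h4kℚ, hvdv]
    exact isMinimalAt_twistModel v W (IsGloballyMinimal.isMinimal v)
      (valuation_ringOfIntegers_intCast_le_one v k) hv4k

/-- **The globally minimal model of the Heegner twist with unit scaling, for every odd `d_K`.**
`W/ℚ` globally minimal, `K` imaginary quadratic with `d_K` odd satisfying the Heegner hypothesis for
`N(W)`: every prime `q ∣ d_K` ramifies in `K`, so does not split, so `q ∤ N` and `W` is good at `q`;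
`d_K ≡ 1 (mod 4)` is squarefree; hence (`isGloballyMinimal_twistModel_of_squarefree`) the integral
twist model `T = W.twistModel ((d_K − 1)/4)` is globally minimal, and `T = Cd • W^{(d_K)}` with
`u(Cd) = 1` (`exists_variableChange_twistModel_eq_quadraticTwist`). The prime case is file VI's
`exists_isGloballyMinimal_twist_of_prime_discr`. [cite: SilvermanAEC2009, VII.1 Remark 1.1 and Prop. 1.3, X.5 Cor. 5.4]
[cite: Stevens1989, Lemma (5.2) p. 96 (sketch of proof)] -/
theorem exists_isGloballyMinimal_twist_of_heegner (W : WeierstrassCurve ℚ) [W.IsElliptic]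
    [W.IsGloballyMinimal] (K : Type) [Field K] [NumberField K] (hK : IsImaginaryQuadratic K)
    (hodd : Odd (NumberField.discr K)) (hH : SatisfiesHeegnerHypothesis (W.conductorNorm ℤ) K) :
    ∃ (Wd : WeierstrassCurve ℚ) (Cd : VariableChange ℚ),
      Cd • W.quadraticTwist (NumberField.discr K : ℚ) = Wd ∧ |(Cd.u : ℚ)| = 1 ∧
        Wd.IsElliptic ∧ Wd.IsGloballyMinimal := by
  set d : ℤ := NumberField.discr K with hd_def
  have hd0 : (d : ℚ) ≠ 0 := by exact_mod_cast NumberField.discr_ne_zero K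
  haveI : (W.quadraticTwist (d : ℚ)).IsElliptic := W.isElliptic_quadraticTwist hd0
  -- `d ≡ 1 (mod 4)`, squarefree
  have h4 : (4 : ℤ) ∣ d - 1 := by
    rcases Quadratic.isFundamentalDiscriminant_discr (K := K) hK.1 with ⟨h1, -, -⟩ | ⟨h4, -, -⟩
    · exact ⟨d / 4, by omega⟩
    · exfalso
      obtain ⟨k, hk⟩ := h4
      obtain ⟨m, hm⟩ := hodd
      omega
  have hsf : Squarefree d := squarefree_discr_of_odd hK hodd
  -- `W` is good at every place dividing `d`
  have hgood : ∀ v : HeightOneSpectrum (𝓞 ℚ), ((primesEquiv v : ℕ) : ℤ) ∣ d →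
      W.HasGoodReductionAt v := by
    intro v hvd
    have hpP : (primesEquiv v : ℕ).Prime := (primesEquiv v).2
    haveI := Fact.mk hpP
    have hp2 : (primesEquiv v : ℕ) ≠ 2 := by
      intro h
      obtain ⟨m, hm⟩ := hodd
      have h2 : (2 : ℤ) ∣ d := by
        have := hvd
        rw [h] at this
        exact_mod_cast this
      omega
    have hpN : ¬ (primesEquiv v : ℕ) ∣ W.conductorNorm ℤ := by
      intro hpN
      refine not_dvd_discr_of_split hK hpP hp2 (fun p hp hpq => ?_) hvd
      rw [(Nat.prime_dvd_prime_iff_eq hp hpP).mp hpq]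
      exact hH _ hpP hpN
    have hgoodp : W.HasGoodReductionAtPrime (primesEquiv v : ℕ) := by
      by_contra h
      exact hpN ((W.dvd_conductorNorm_iff_not_hasGoodReductionAtPrime (primesEquiv v : ℕ)).mpr h)
    exact (W.hasGoodReductionAtPrime_iff_hasGoodReductionAt_ringOfIntegers v).mp hgoodp
  -- the twist model
  set k : ℤ := (d - 1) / 4 with hk
  have hmin := isGloballyMinimal_twistModel_of_squarefree W h4 hsf hgood
  have h4k : (4 : ℤ) * k + 1 = d := by
    have := Int.ediv_mul_cancel h4
    linarith
  have h4kℚ : (4 : ℚ) * ((k : ℤ) : ℚ) + 1 = (d : ℚ) := by exact_mod_cast h4k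
  obtain ⟨C, hCu, hC⟩ := exists_variableChange_twistModel_eq_quadraticTwist W ((k : ℤ) : ℚ)
  rw [h4kℚ] at hC
  refine ⟨W.twistModel ((k : ℤ) : ℚ), C⁻¹, ?_, ?_, ?_, hmin⟩
  · rw [← hC, inv_smul_smul]
  · have : (C⁻¹.u : ℚ) = ((C.u : ℚ))⁻¹ := by rw [VariableChange.inv_def]; simp
    rw [this, hCu]; simp
  · have h : W.twistModel ((k : ℤ) : ℚ) = C⁻¹ • W.quadraticTwist (d : ℚ) := by
      rw [← hC, inv_smul_smul]
    rw [h]; infer_instance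

/-! ## §2 The `2`-adic Tamagawa product of the twist, prime by prime and in total -/

section Local

variable (W : WeierstrassCurve ℚ) [W.IsElliptic] [W.IsGloballyMinimal]
  (K : Type) [Field K] [NumberField K] (hK : IsImaginaryQuadratic K)
  (hodd : Odd (NumberField.discr K)) (hH : SatisfiesHeegnerHypothesis (W.conductorNorm ℤ) K)
  {Wd : WeierstrassCurve ℚ} [Wd.IsElliptic] (Cd : VariableChange ℚ)
  (hWd : Cd • W.quadraticTwist (NumberField.discr K : ℚ) = Wd)

include hK hodd hH hWd in
/-- **`ord₂ c_ℓ(E^{(d_K)})` at every prime `ℓ`, for every odd `d_K`:**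
`ord₂ c_ℓ(Wd) = ord₂ c_ℓ(W) + [ℓ ∣ d_K]·([(Δ/ℓ) = −1] + 2·[(Δ/ℓ) = 1 ∧ a_ℓ even])`. Off `d_K` this
is `padicValNat_localTamagawaNumber_twist_eq_of_not_dvd_discr` (IIIb); at `ℓ ∣ d_K` (`ℓ` odd,
`ℓ ∥ d_K`, `ℓ` ramified hence `ℓ ∤ N`, `W` good at `ℓ`, `c_ℓ(W) = 1`, `ℓ ∤ Δ_min`) the twist is of
type `I₀*` with `c_ℓ = #Ẽ(𝔽_ℓ)[2]` (`TwistIstar.padicValNat_two_localTamagawaNumber_twist_of_dvd`).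
`Δ = W.Δ.num` is the minimal discriminant. [cite: Kramer1981, Prop. 3]
[cite: BoxerDiao2010, proof of Prop. 4.1 (p. 1977)] -/
theorem padicValNat_two_localTamagawaNumber_twist_eq_add_of_heegner (ℓ : ℕ) [Fact ℓ.Prime] :
    padicValNat 2 ((Wd.baseChange ℚ_[ℓ]).localTamagawaNumber ℤ_[ℓ]) =
      padicValNat 2 ((W.baseChange ℚ_[ℓ]).localTamagawaNumber ℤ_[ℓ]) +
        (if (ℓ : ℤ) ∣ NumberField.discr K then
          ((if jacobiSym W.Δ.num ℓ = -1 then 1 else 0) +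
            (if jacobiSym W.Δ.num ℓ = 1 ∧ Even (W.frobeniusTrace ℓ) then 2 else 0))
        else 0) := by
  have hℓP : ℓ.Prime := Fact.out
  set d : ℤ := NumberField.discr K with hd_def
  by_cases hℓd : (ℓ : ℤ) ∣ d
  · rw [if_pos hℓd]
    have hℓ2 : ℓ ≠ 2 := by
      intro h
      obtain ⟨m, hm⟩ := hodd
      have h2 : (2 : ℤ) ∣ d := by
        have := hℓd
        rw [h] at this
        exact_mod_cast this
      omega
    have hsq : ¬ ((ℓ : ℤ)) ^ 2 ∣ d := by
      intro h
      have hsf := squarefree_discr_of_odd hK hodd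
      have hunit := hsf (ℓ : ℤ) (by rw [← sq]; exact h)
      rw [Int.isUnit_iff_natAbs_eq, Int.natAbs_natCast] at hunit
      exact hℓP.one_lt.ne' hunit
    -- `ℓ` ramifies, hence does not split, hence `ℓ ∤ N` and `W` is good at `ℓ`
    have hℓN : ¬ ℓ ∣ W.conductorNorm ℤ := by
      intro hℓN
      refine not_dvd_discr_of_split hK hℓP hℓ2 (fun p hp hpq => ?_) hℓd
      rw [(Nat.prime_dvd_prime_iff_eq hp hℓP).mp hpq]
      exact hH ℓ hℓP hℓN
    have hgood : W.HasGoodReductionAtPrime ℓ := by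
      by_contra h
      exact hℓN ((W.dvd_conductorNorm_iff_not_hasGoodReductionAtPrime ℓ).mpr h)
    haveI : (W.baseChange ℚ_[ℓ]).IsElliptic :=
      inferInstanceAs (W.map (algebraMap ℚ ℚ_[ℓ])).IsElliptic
    have hcW : (W.baseChange ℚ_[ℓ]).localTamagawaNumber ℤ_[ℓ] = 1 := by
      haveI : ((W.baseChange ℚ_[ℓ]).minimal ℤ_[ℓ]).HasGoodReduction ℤ_[ℓ] := hgood
      exact localTamagawaNumber_eq_one_of_hasGoodReduction_holds ℤ_[ℓ] _
    have hℓΔ : ¬ (ℓ : ℤ) ∣ minimalDiscriminantInt W :=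
      not_dvd_minimalDiscriminantInt_of_hasGoodReductionAtPrime' W ℓ hgood
    rw [hcW, padicValNat_one_right, zero_add]
    exact TwistIstar.padicValNat_two_localTamagawaNumber_twist_of_dvd W ℓ hℓ2 hℓΔ hℓd hsq Cd hWd
  · rw [if_neg hℓd, add_zero]
    exact padicValNat_localTamagawaNumber_twist_eq_of_not_dvd_discr W K hK hodd hH Cd hWd 2 ℓ hℓd

/-- `ord_p` of a finite product of non-zero naturals is the sum of the `ord_p`. [folklore] -/
private theorem padicValNat_finset_prod₃ (p : ℕ) [Fact p.Prime] {ι : Type*} (s : Finset ι)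
    (f : ι → ℕ) (hf : ∀ i ∈ s, f i ≠ 0) :
    padicValNat p (∏ i ∈ s, f i) = ∑ i ∈ s, padicValNat p (f i) := by
  induction s using Finset.induction_on with
  | empty => simp
  | insert a s ha ih =>
    rw [Finset.prod_insert ha, Finset.sum_insert ha,
      padicValNat.mul (hf a (Finset.mem_insert_self a s))
        (Finset.prod_ne_zero_iff.mpr fun i hi => hf i (Finset.mem_insert_of_mem hi)),
      ih fun i hi => hf i (Finset.mem_insert_of_mem hi)]

include hK hodd hH hWd in
/-- **`ord₂ ∏_ℓ c_ℓ(E^{(d_K)}) = ord₂ ∏_ℓ c_ℓ(E) + Σ_{q ∣ d_K} ([(Δ/q) = −1] + 2·[(Δ/q) = 1 ∧ a_q even])`**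
for EVERY odd `d_K` (Heegner field of the globally minimal `W`; `Wd = Cd • W^{(d_K)}` any equation
of the twist; the sum over the prime factors `q` of `|d_K|`; `Δ = W.Δ.num` the minimal
discriminant): both Tamagawa products are finite products over the bad places and the places over
`d_K` (`tamagawaProduct_eq_prod`), compared prime by prime
(`padicValNat_two_localTamagawaNumber_twist_eq_add_of_heegner`), and the places `v` with `ℓ_v ∣ d_K`
correspond to the prime factors of `|d_K|`. The prime case is IIIb's
`padicValNat_two_tamagawaProduct_twist_of_heegner_of_prime_discr`.
[cite: Kramer1981, Prop. 3] [cite: JetchevSkinnerWan2017, §7.4.1 (eq:tamK) (pp. 29–31)] -/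
theorem padicValNat_two_tamagawaProduct_twist_of_heegner :
    padicValNat 2 Wd.tamagawaProduct = padicValNat 2 W.tamagawaProduct +
      ∑ q ∈ (NumberField.discr K).natAbs.primeFactors,
        ((if jacobiSym W.Δ.num q = -1 then 1 else 0) +
          (if jacobiSym W.Δ.num q = 1 ∧ Even (W.frobeniusTrace q) then 2 else 0)) := by
  haveI : Fact (Nat.Prime 2) := ⟨Nat.prime_two⟩
  set d : ℤ := NumberField.discr K with hd_def
  have hdZ : d ≠ 0 := NumberField.discr_ne_zero K
  -- the local defect as a function of the prime
  set f : ℕ → ℕ := fun q ↦ (if jacobiSym W.Δ.num q = -1 then 1 else 0) +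
    (if jacobiSym W.Δ.num q = 1 ∧ Even (W.frobeniusTrace q) then 2 else 0) with hf
  have hfW : (W.badPlaces ℤ).Finite := W.finite_badPlaces_holds ℤ
  have hfWd : (Wd.badPlaces ℤ).Finite := Wd.finite_badPlaces_holds ℤ
  -- the places of `ℤ` over the prime factors of `|d_K|`
  set T : Finset ℕ := d.natAbs.primeFactors with hT
  set Sd : Finset (IsDedekindDomain.HeightOneSpectrum ℤ) :=
    T.attach.image (fun q ↦ primesEquiv.symm ⟨q.1, Nat.prime_of_mem_primeFactors q.2⟩) with hSd
  set s : Finset (IsDedekindDomain.HeightOneSpectrum ℤ) :=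
    hfW.toFinset ∪ hfWd.toFinset ∪ Sd with hs
  have hsW : ∀ v, ¬ W.HasGoodReductionAt v → v ∈ s := fun v hv ↦
    Finset.mem_union_left _ (Finset.mem_union_left _
      (by rw [Set.Finite.mem_toFinset, mem_badPlaces_iff]; exact hv))
  have hsWd : ∀ v, ¬ Wd.HasGoodReductionAt v → v ∈ s := fun v hv ↦
    Finset.mem_union_left _ (Finset.mem_union_right _
      (by rw [Set.Finite.mem_toFinset, mem_badPlaces_iff]; exact hv))
  rw [tamagawaProduct_eq_prod W s hsW, tamagawaProduct_eq_prod Wd s hsWd,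
    padicValNat_finset_prod₃ 2 s _ fun v _ ↦ ?_, padicValNat_finset_prod₃ 2 s _ fun v _ ↦ ?_]
  · -- termwise
    have hterm : ∀ v ∈ s,
        padicValNat 2 (haveI := Fact.mk (primesEquiv v).2
          (Wd.baseChange ℚ_[primesEquiv v]).localTamagawaNumber ℤ_[primesEquiv v]) =
        padicValNat 2 (haveI := Fact.mk (primesEquiv v).2
          (W.baseChange ℚ_[primesEquiv v]).localTamagawaNumber ℤ_[primesEquiv v]) +
          (if ((primesEquiv v : ℕ) : ℤ) ∣ d then f (primesEquiv v) else 0) := by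
      intro v _
      haveI := Fact.mk (primesEquiv v).2
      exact padicValNat_two_localTamagawaNumber_twist_eq_add_of_heegner W K hK hodd hH Cd hWd
        (primesEquiv v)
    rw [Finset.sum_congr rfl hterm, Finset.sum_add_distrib, ← Finset.sum_filter]
    congr 1
    -- the places `v ∈ s` with `ℓ_v ∣ d_K` ↔ the prime factors of `|d_K|`
    refine Finset.sum_bij' (fun v _ ↦ (primesEquiv v : ℕ))
      (fun q hq ↦ primesEquiv.symm ⟨q, Nat.prime_of_mem_primeFactors hq⟩) ?_ ?_ ?_ ?_ ?_
    · intro v hv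
      rw [Finset.mem_filter] at hv
      rw [hT, Nat.mem_primeFactors]
      exact ⟨(primesEquiv v).2, Int.natCast_dvd_natCast.mp (Int.dvd_natAbs.mpr hv.2),
        Int.natAbs_ne_zero.mpr hdZ⟩
    · intro q hq
      rw [Finset.mem_filter]
      refine ⟨Finset.mem_union_right _ ?_, ?_⟩
      · rw [hSd, Finset.mem_image]
        exact ⟨⟨q, hq⟩, Finset.mem_attach _ _, rfl⟩
      · rw [Equiv.apply_symm_apply]
        exact Int.dvd_natAbs.mp (Int.natCast_dvd_natCast.mpr (Nat.dvd_of_mem_primeFactors hq))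
    · intro v _
      apply primesEquiv.injective
      rw [Equiv.apply_symm_apply]
      exact Subtype.ext rfl
    · intro q _
      rw [Equiv.apply_symm_apply]
    · intro v _
      rfl
  · haveI := Fact.mk (primesEquiv v).2
    haveI : (Wd.baseChange ℚ_[primesEquiv v]).IsElliptic :=
      inferInstanceAs (Wd.map (algebraMap ℚ ℚ_[primesEquiv v])).IsElliptic
    exact localTamagawaNumber_padic_ne_zero_holds (primesEquiv v) _
  · haveI := Fact.mk (primesEquiv v).2
    haveI : (W.baseChange ℚ_[primesEquiv v]).IsElliptic :=
      inferInstanceAs (W.map (algebraMap ℚ ℚ_[primesEquiv v])).IsElliptic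
    exact localTamagawaNumber_padic_ne_zero_holds (primesEquiv v) _

end Local

end Summit.BirchSwinnertonDyer.BirchSwinnertonDyer.Theorems.ShaCountTwo

end
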